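import Mathlib.Analysis.SpecialFunctions.SmoothTransition
import Mathlib.Analysis.Calculus.BumpFunction.Basic
import Mathlib.Analysis.Calculus.BumpFunction.InnerProduct
import Mathlib.Analysis.InnerProductSpace.PiL2
import Mathlib.Analysis.Calculus.Deriv.Inv
import HarnessLib

/-!
# The collar profile and the box bump of Kas' Morse function

Topic `Literature/Geometry/Symplectic` (fact seat
`provefact-Literature.Geometry.Symplectic.Oba2016_s-add47373d4`; two elementary smooth functions
entering Kas' function `‖f - c₀‖² + ε (bb ∘ σ + β(f) · D)`, Kas 1980 §2).  Everything is proved;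
no definitions, no named facts.

* `exists_collarProfile` — for `c > 0` a smooth `bb : ℝ → ℝ` with values in `(0, 1)`, constant
  on `[2c, ∞)` and with `bb' < 0` on `(-∞, 2c)` (`bb t = 1/2 + expNegInvGlue (2c - t) / 4`);
* `exists_boxBump` — for `0 < δ' < δ''` and `c₀ ∈ ℝ²` a smooth `β : ℝ² → ℝ` equal to `1` on the
  closed `δ'`-box about `c₀` and to `0` off the open `δ''`-box (a product of one-variable bumps).

## References

* A. Kas, *On the handlebody decomposition associated to a Lefschetz fibration*, Pacific J.
  Math. 89 (1980), §2. [Kas1980]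
-/

open scoped ContDiff Topology
open Set Function Filter Real

noncomputable section

namespace Literature.Geometry.Symplectic

/-- The derivative of `expNegInvGlue` at a positive point is positive. [folklore] -/
theorem hasDerivAt_expNegInvGlue_of_pos {x : ℝ} (hx : 0 < x) :
    HasDerivAt expNegInvGlue (exp (-x⁻¹) * (x ^ 2)⁻¹) x := by
  have hev : expNegInvGlue =ᶠ[𝓝 x] fun y => exp (-y⁻¹) := by
    filter_upwards [Ioi_mem_nhds hx] with y hy
    simp [expNegInvGlue, not_le.2 (mem_Ioi.1 hy)]
  have h1 : HasDerivAt (fun y : ℝ => -y⁻¹) ((x ^ 2)⁻¹) x := by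
    have h := (hasDerivAt_inv hx.ne').neg
    exact h.congr_deriv (by ring)
  have h2 : HasDerivAt (fun y : ℝ => exp (-y⁻¹)) (exp (-x⁻¹) * (x ^ 2)⁻¹) x := h1.exp
  exact h2.congr_of_eventuallyEq hev

/-- **The collar profile.**  For `c > 0` there is a smooth `bb : ℝ → ℝ` with `0 < bb < 1`,
`bb t = bb (2c)` for `t ≥ 2c` and `bb' t < 0` for `t < 2c`. [cite: Kas1980, §2] -/
theorem exists_collarProfile {c : ℝ} (hc : 0 < c) :
    ∃ bb : ℝ → ℝ, ContDiff ℝ ∞ bb ∧ (∀ t, bb t < 1) ∧ (∀ t, 0 < bb t) ∧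
      (∀ t, 2 * c ≤ t → bb t = bb (2 * c)) ∧ ∀ t, t < 2 * c → deriv bb t < 0 := by
  have _ := hc
  set bb : ℝ → ℝ := fun t => 1 / 2 + expNegInvGlue (2 * c - t) / 4 with hbb
  have hsmooth : ContDiff ℝ ∞ bb :=
    contDiff_const.add ((expNegInvGlue.contDiff.comp (contDiff_const.sub contDiff_id)).div_const 4)
  have hlt1 : ∀ x, expNegInvGlue x < 1 := by
    intro x
    rcases le_or_gt x 0 with h | h
    · rw [expNegInvGlue.zero_of_nonpos h]; exact one_pos
    · simp only [expNegInvGlue, not_le.2 h, if_false]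
      rw [Real.exp_lt_one_iff]
      have : 0 < x⁻¹ := inv_pos.2 h
      linarith
  refine ⟨bb, hsmooth, fun t => ?_, fun t => ?_, fun t ht => ?_, fun t ht => ?_⟩
  · show 1 / 2 + expNegInvGlue (2 * c - t) / 4 < 1
    linarith [hlt1 (2 * c - t)]
  · show 0 < 1 / 2 + expNegInvGlue (2 * c - t) / 4
    linarith [expNegInvGlue.nonneg (2 * c - t)]
  · show 1 / 2 + expNegInvGlue (2 * c - t) / 4 = 1 / 2 + expNegInvGlue (2 * c - 2 * c) / 4
    rw [expNegInvGlue.zero_of_nonpos (by linarith), sub_self, expNegInvGlue.zero]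
  · have hx : 0 < 2 * c - t := by linarith
    have h1 : HasDerivAt (fun s : ℝ => 2 * c - s) (-1) t :=
      ((hasDerivAt_const t (2 * c)).sub (hasDerivAt_id t)).congr_deriv (by ring)
    have h2 : HasDerivAt (fun s : ℝ => expNegInvGlue (2 * c - s))
        (exp (-(2 * c - t)⁻¹) * ((2 * c - t) ^ 2)⁻¹ * (-1)) t :=
      (hasDerivAt_expNegInvGlue_of_pos hx).comp t h1
    have h3 : HasDerivAt bb ((exp (-(2 * c - t)⁻¹) * ((2 * c - t) ^ 2)⁻¹ * (-1)) / 4) t := by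
      have h := (h2.div_const 4).const_add (1 / 2)
      exact h
    rw [h3.deriv]
    have h4 : 0 < exp (-(2 * c - t)⁻¹) * ((2 * c - t) ^ 2)⁻¹ := by positivity
    linarith

/-- **The box bump.**  For `0 < δ' < δ''` and `c₀ ∈ ℝ²` there is a smooth `β : ℝ² → ℝ` with
`β = 1` on the closed `δ'`-box about `c₀` and `β u = 0` as soon as some coordinate of `u - c₀`
has absolute value `≥ δ''`. [folklore] -/
theorem exists_boxBump (c₀ : EuclideanSpace ℝ (Fin 2)) {δ' δ'' : ℝ} (h0 : 0 < δ') (h : δ' < δ'') :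
    ∃ β : EuclideanSpace ℝ (Fin 2) → ℝ, ContDiff ℝ ∞ β ∧
      (∀ u : EuclideanSpace ℝ (Fin 2), (∀ i, |u i - c₀ i| ≤ δ') → β u = 1) ∧
      ∀ (u : EuclideanSpace ℝ (Fin 2)) (i : Fin 2), δ'' ≤ |u i - c₀ i| → β u = 0 := by
  set b₁ : ContDiffBump (0 : ℝ) := ⟨δ', δ'', h0, h⟩ with hb₁
  set β : EuclideanSpace ℝ (Fin 2) → ℝ := fun u => ∏ i, b₁ (u i - c₀ i) with hβ
  refine ⟨β, ?_, fun u hu => ?_, fun u i hi => ?_⟩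
  · refine contDiff_prod fun i _ => b₁.contDiff.comp ?_
    exact (EuclideanSpace.proj i : EuclideanSpace ℝ (Fin 2) →L[ℝ] ℝ).contDiff.sub contDiff_const
  · show ∏ i, b₁ (u i - c₀ i) = 1
    refine Finset.prod_eq_one fun i _ => b₁.one_of_mem_closedBall ?_
    rw [Metric.mem_closedBall, dist_zero_right, Real.norm_eq_abs]
    exact hu i
  · show ∏ i, b₁ (u i - c₀ i) = 0
    refine Finset.prod_eq_zero (Finset.mem_univ i) (b₁.zero_of_le_dist ?_)
    rw [dist_zero_right, Real.norm_eq_abs]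
    exact hi

end Literature.Geometry.Symplectic

end
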